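import Summits.QuantumFields.YangMills.Theorems.VirialFluxGapPeriodicSoftnessOfWindow
import Summits.QuantumFields.YangMills.Theorems.VirialFluxGapCentralDriveWindow
import HarnessLib

/-!
# Route `VirialFluxGap` (YangMills): the deciding crux `PeriodicSoftness` — CLOSING FILE (item stmt-QuantumFields-24141)

★★★ `periodicSoftness : Summit.QuantumFields.YangMills.Theses.VirialFluxGap.PeriodicSoftness`, BY NAME, unconditionally:
✓`periodicSoftness_of_window` (assembly Part X, this seat) applied to w2 g53's ✓`CentralField.central_drive_window'` — the windowed drive
inequality (P2) of w3 g59's explicit central field `centralCoeff L σ σ₄` with the explicit loss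
`ε_C(L, ρ, t_C) = ½·[9216L⁴t_C + (384L²√t_C + 6(ρ + 16L²√t_C))(3 + 147456L⁴(3L³ + 6L⁴))]`, itself one application of w3 g59's Euler-defect core
✓`CentralDrive.central_drive_lower`.

The chain behind it (all in the tree, all sorry-free): frame-derivative calculus and virial identity (`FrameDerivative`, `RingVirial`, `FixFrame`,
`RegCutoff`), the patched smooth frame field `c = ψ(F/t₀)·(χ_reg·2X_{λ⋆} + (1 − χ_reg)·C)` and its point ∕ collar ∕ central-window packages
(`FixGenericFloor`, `PatchingBudget`, `PatchingCalculus`, `AssemblyPointPackage`, `AssemblyScale`, `AssemblyPackages`, `AssemblyOfCentralField`),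
w2's `periodicSoftness_of_smoothFrameField_cutoff`, the central sign patching ∕ sign plug (`CentralSignPatching`, `CentralSignPlug`), the central
mass monotonicity (P4) (`CentralMassMonotonicity[Window]`), w2 g53's (P3) `central_divergence_window`, w3 g59's (P2) `EulerDefectAlgebra` ∕
`EulerDefectInequality` ∕ `CentralDriveTerms` ∕ `CentralDrive`, w2 g53's `CentralDriveWindow`, and the closing arithmetic `ρ = (10¹²L¹⁴)⁻¹`,
`t_C = (10²⁴L²⁸)⁻¹` (`ClosingArithmetic`, `PeriodicSoftnessOfDrive`, `PeriodicSoftnessOfWindow`).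

HONEST LABEL: this closes ONE LEAF (`PeriodicSoftness`, item ⟨24141⟩) of the DRAFT route `VirialFluxGap` (glue flagged conclusion-mismatch by the
planner); ⟨22884⟩ and the route's assembly remain OPEN; the Yang–Mills mass gap is NOT proved; no summit is proved by a line.  THEOREMS ONLY
(0 `def`, 0 `sorry`), standard axioms.  Explicit-unit seat `ym-line-fcl-p3` g41 (cell ym-idea-1; default assembler by LEAD ruling), with
w2 g52∕g53, w3 g59, LEAD sfw-p2 g92.  References: [cite: Luscher1983, §2]; [cite: CosteEtAl1985]; [folklore].
-/

set_option autoImplicit false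

noncomputable section

namespace Summit.QuantumFields.YangMills.Theorems.VirialFluxGap.FrameHessian

open Summit.QuantumFields.YangMills.Theorems.VirialFluxGap.CentralField

/-- ★★★ The deciding crux `VirialFluxGap.PeriodicSoftness` (item stmt-QuantumFields-24141), BY NAME and unconditionally:
✓`periodicSoftness_of_window` applied to w2 g53's windowed drive inequality ✓`central_drive_window'` of w3 g59's explicit central field
(Euler-defect core ✓`central_drive_lower`).  HONEST LABEL: one leaf of a DRAFT route; the Yang–Mills mass gap is NOT proved.
[cite: Luscher1983, §2] [cite: CosteEtAl1985] [folklore] -/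
theorem periodicSoftness : Summit.QuantumFields.YangMills.Theses.VirialFluxGap.PeriodicSoftness :=
  periodicSoftness_of_window
    (fun _ _ _ _ hσ hσ₄ x _ _ hρ0 hρ5 htC hk hs hW hS hF =>
      central_drive_window' hσ hσ₄ x hρ0 hρ5 htC hk hs hW hS hF)

end Summit.QuantumFields.YangMills.Theorems.VirialFluxGap.FrameHessian

end
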